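import Literature.Analysis.FunctionSpaces.TorusFluidGlue
import Literature.Analysis.FunctionSpaces.TorusSobolevNorm
import Literature.Analysis.FluidPDE.CriticalSpaces
import HarnessLib

/-!
# Barrier: arbitrary norm growth from smooth data bounded in a critical space (Palasek 2025)

Barrier catalogue entry for `NavierStokesRegularity` (D-0021). Vendors **Theorem 1.1** of
S. Palasek, *Arbitrary norm growth in the 3D Navier–Stokes equations*, arXiv:2509.18595 (2025)
[`Palasek2025`] as ONE named fact `CriticalDataArbitraryNormGrowth` over the accepted torus
vocabulary, and PROVES from it the failure of a priori estimates of the printed Corollary 1.5 in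
the sup-norm form (E2)₀ (`CriticalDataArbitraryNormGrowth.not_apriori_sqrt_mul_norm_le`, with the
data-dependent time `T = T(‖u₀‖)` of the sentence after Cor. 1.5, and its fixed-`T` special case
`CriticalDataArbitraryNormGrowth.not_apriori_sqrt_mul_norm_le_fixed`), through the quantitative core
of the printed proofs of Cor. 1.5 / Cor. 1.8 (`CriticalDataArbitraryNormGrowth.exists_sqrt_mul_norm_gt`:
inside ONE ball of `B^{-1}_{∞,1}` there are smooth data whose global solutions make
`√t ‖u(t)‖_∞` exceed any `M` before any `T`).

## What is printed (arXiv:2509.18595)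

* Setting (§1): the unforced incompressible Navier–Stokes equations on `𝕋³ = (ℝ/2πℤ)³`,
  viscosity normalised to `ν = 1`, classical solutions (smooth on `𝕋³ × [0,T)`) from smooth
  divergence-free data `u⁰`; unique local solution, maximal time `T_*`.
* **Thm. 1.1.** "Let `Θ_* ∈ ℝ³` and `η_* ∈ ℤ³` be any non-zero vectors satisfying `Θ_*·η_* = 0`.
  For any `ε_* > 0` and `n_max ∈ ℕ`, there exists divergence-free initial data `u⁰ ∈ C^∞(𝕋³)`
  with `‖u⁰‖_{B^{-1}_{∞,1}} ≤ 10⁵` and such that the corresponding strong solution of (NS) is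
  global and satisfies `u(x,t) = Θ_* sin(x·η_*) exp(−|η_*|²t) + E` where
  `‖∇ⁿE(t)‖_{L^∞(𝕋³)} ≤ ε_*` for all `t ∈ [½|η_*|⁻², 2|η_*|⁻²]`, `n = 0, 1, …, n_max`."
  "The strength of the theorem comes from taking `|Θ_*|` arbitrarily large."
* Rem. 1.2: `B^{-1}_{∞,1} ⊂ BMO⁻¹` boundedness (Koch–Tataru class); `BMO⁻¹ ∩ C^∞ ⊂ VMO⁻¹`, a
  space with local well-posedness; "the upper bound `10⁵` is far from optimal". §1.3: the Besov
  norm is the Littlewood–Paley one, `‖u‖_{B^s_{p,q}} = ‖N^s‖P_N u‖_{L^p}‖_{ℓ^q(2^ℕ)}` with a fixed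
  smooth dyadic partition (cut-off supported in `(2/3, 3/2)`), for zero-average fields (so
  `B = Ḃ`); "an alternative definition … `‖f‖_{B^s_{p,q}} ∼ ‖t^{-s/2}e^{tΔ}f‖_{L^q((0,∞),dt/t;L^p)}`".
* **Cor. 1.5.** For any `T > 0` and non-decreasing `f : [0,∞) → [0,∞)`, each of the following
  hypothetical a priori estimates over `𝒳_∞ = {u⁰ ∈ C^∞_{df}(𝕋³) with a global strong solution}`
  FAILS: (E1) `sup_{t∈(0,T)} ‖u(t)‖_{BMO⁻¹} ≤ f(‖u⁰‖_{BMO⁻¹})`; (E2)ₙ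
  `sup_{t∈(0,T)} t^{(1+n)/2}‖∇ⁿu(t)‖_∞ ≤ f(‖u⁰‖_{BMO⁻¹})` (any `n ≥ 0`); (E3) localised
  enstrophy `sup_t t^{1/4}‖ω(t)‖_{L²(B(0,√t))} ≤ f(…)`; (E4) dynamically localised
  Prodi–Serrin norms `‖u‖_{L^p([T/2,T];L^q(B(√t)))} ≤ f(…)`, `2/p + 3/q = 1`. "More strongly,
  (E1)–(E4) fail even if the fixed time `T` is replaced by a non-increasing function of the size of
  the data: `T = T(‖u⁰‖_{BMO⁻¹})`." **Rem. 1.6**: "the results continue to hold when [`BMO⁻¹`] is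
  replaced with the stronger norm `B^{-1}_{∞,1}`", and (E1) fails even as
  `sup_t ‖u(t)‖_{B^{-1}_{∞,∞}} ≤ f(‖u⁰‖_{B^{-1}_{∞,1}})`. Rem. 1.7: "essentially any scale-invariant
  measure of the solution on the left-hand side". Cor. 1.8: the Koch–Tataru Picard scheme fails to
  converge in any ball of `X_T` from suitable data in `B_{VMO⁻¹}(0,r₀) ∩ C^∞`.
* §1.2 (mechanism): data supported in ONE frequency shell `N_{k_*}`; an AUTONOMOUS inverse
  cascade `N_{k_*} → N_{k_*−1} → … → N₀` of high-high-to-low interactions, "growth resulting from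
  repeated squaring by the quadratic nonlinearity", `C_k ∼ N_k(C₀/N₀)^{2^{-k}}`, each spent shell
  erased by the heat flow; "since there is no force or convex integration-type correction for
  `t > 0`, all of this behavior must be autonomous and encoded in the initial data"; growth needs
  LARGE data (`C₀ ≫ N₀`), consistent with Koch–Tataru. §3: the proofs of Cor. 1.5 / 1.8 apply
  Thm. 1.1 with `Θ_* = n e₁`, `η_* = m e₂`, `ε_* = 1`, `n_max = 0`, giving
  `‖u_{n,m}(m⁻²)‖_∞ ≳ n − 1` and `sup_{t∈[0,T]} t^{1/2}‖u_{n,m}(t)‖_∞ ≳ (n−1)/m`, "taking `m` large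
  depending on `T`, then `n` large depending on `m` and `f(r₀)`".

## Rendering (unit torus, tree vocabulary; WEAKER than print)

* The tree's torus is the UNIT torus `UnitAddTorus (Fin 3) = (ℝ/ℤ)³`
  (`Literature.Analysis.FunctionSpaces.Torus.*`): Palasek's solution `u` on `(ℝ/2πℤ)³` is transported by the
  Navier–Stokes scaling `v(s,y) = 2π u(4π²s, 2πy)`, `q(s,y) = 4π² p(4π²s, 2πy)`, which keeps
  `ν = 1`, maps the leading term to `(2πΘ_*) sin(2π η_*·y) e^{−4π²|η_*|²s}` — the datum of the
  tree's exact shear-wave solution `Literature.Analysis.FluidPDE.Torus.isClassicalNSSolutionOn_shearWave`,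
  written here identically as `(mFourier η y).im • Θ`, `mFourier η = e^{2πiη·y}` — and the window
  `t ∈ [½|η|⁻², 2|η|⁻²]` to `s ∈ [1/(8π²|η|²), 1/(2π²|η|²)]` (`|η|² = Torus.freqNormSq η`).
* Classical global solution: `Torus.IsClassicalNSSolutionOn (Ici 0) 1 0 v q` with `v 0 = v₀`
  (jointly smooth on `[0,∞) × 𝕋³`, pointwise equations, unforced), as in the sibling
  `CriticalDataSmoothNonuniqueness`; the datum is smooth, divergence free and of zero mean (the
  printed data are frequency-localised in a shell `N_{k_*} ≥ 1`, §1.2/§2).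
* The error bound is recorded for ALL `n ≤ n_max` through `iteratedFDeriv ℝ n` of the periodic
  lift `Torus.lift` of the slice `v(s) − (leading term)`; the rescaling costs the factor
  `(2π)^{n+1}` and the passage from `‖∇ⁿE‖_∞` to the operator norm of the `n`-th Fréchet
  derivative a factor `c(n)`, both absorbed in the arbitrary `ε_*`.
* The critical norm: `‖v₀‖_{Ḃ^{-1}_{∞,1}}` is read off the tempered distribution `U₀` of the
  (bounded, smooth, `ℤ³`-periodic) lift `Torus.lift v₀` on `ℝ³`
  (`Literature.Analysis.FluidPDE.IsDistributionOf`, `Literature.Analysis.FunctionSpaces.eHomBesovNorm (-1) ∞ 1`,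
  the canonical Littlewood–Paley norm of `FunctionSpaces/LittlewoodPaley`, BCD Def. 2.15): for a
  zero-mean periodic field the whole-space dyadic blocks are the periodic Littlewood–Paley pieces,
  so this IS a torus `B^{-1}_{∞,1}` norm with the tree's cut-off. Palasek's cut-off and period
  differ from the tree's; different admissible cut-offs give equivalent norms and the dilation by
  `2π` changes a homogeneous Besov norm by a bounded factor (BCD Rem. 2.17, Prop. 2.18 / Cor. 2.70),
  so the printed `10⁵` becomes SOME absolute constant: the fact asserts `∃ C` (a fixed
  `ℝ≥0`, uniform in `Θ, η, ε, n_max`) — weaker than print, and exactly what Cor. 1.5 consumes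
  ("`r₀` an absolute constant").
* Cor. 1.5 is proved here in the form (E2)₀ with `B^{-1}_{∞,1}` on the right-hand side, which is
  printed (Rem. 1.6) and is the STRONGEST of the printed right-hand sides (`B^{-1}_{∞,1}` is the
  smallest data norm in the chain, so estimates in terms of it are the hardest to violate); `f`
  non-decreasing becomes `F : ℝ≥0∞ → ℝ` monotone (the norm is `ℝ≥0∞`-valued; real-valued `F`
  as printed), `T(·)` non-increasing becomes `Tf : ℝ≥0∞ → ℝ` antitone and positive; the class
  `𝒳_∞` becomes "smooth divergence-free zero-mean datum with A global classical solution
  `(v, q)`" — classical solutions from smooth data on `𝕋³` are unique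
  (`Torus.IsClassicalNSSolutionOn.eq_of_eq_zero`-type results in `FunctionSpaces/TorusClassicalNSUniqueness`),
  and in any case refuting the estimate for ONE global solution of the datum refutes the printed
  "for the solution" form, so the proved negations are implied by (and, given uniqueness,
  equivalent to) the printed ones.

## What is NOT here

(E1), (E3), (E4), (E2)ₙ for `n ≥ 1`, Cor. 1.8 (Picard divergence in `X_T`) and the `BMO⁻¹`
right-hand sides are printed but not threaded (each needs one more piece of vocabulary: the torus
`BMO⁻¹` / `Ḃ^{-1}_{∞,∞}` norm of the slices, localised enstrophy, Koch–Tataru's `X_T`); the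
constant `10⁵`; Rem. 1.3 / 1.4 (extensions announced as likely, without proof). Nothing here is a regularity or blow-up
statement: every solution in the fact is GLOBAL and smooth.

## Why it is catalogued as a barrier, and for whom

The shape "critical quantity of the solution `≤ F(critical norm of the datum)`" is the natural
first guess for a quantitative regularity / Type-II-exclusion estimate (Tao's programme:
regularity ⟺ an a priori bound `‖u(T)‖_{H¹} ≤ F(‖u⁰‖_{H¹})`, arXiv:0710.1604 Thm. 1.4/Cor. 1.5, and
its critical analogues for `Ḣ^{1/2}`, `L³` by Rusin–Šverák / Jia–Šverák); Palasek's corollary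
says that in the borderline critical spaces `B^{-1}_{∞,1} ⊂ BMO⁻¹` NO such estimate holds, not
even restricted to data that DO have global smooth solutions — so regularity, if true, is not
"quantitative from `BMO⁻¹`". For the cell's blow-up side (N1, `PalasekTowerBreakdown`,
cruxes `HeredityAtOne` / `HeredityFromTwo`: AUTONOMOUS level-to-level hand-over after the force
is switched off) Thm. 1.1 is the nearest printed theorem exhibiting an autonomous, timed,
self-erasing multi-level cascade in true Navier–Stokes — in the INVERSE direction (high → low
frequency), with critical-norm amplitude as the transferred currency.

## References

* S. Palasek, *Arbitrary norm growth in the 3D Navier–Stokes equations*, arXiv:2509.18595 (2025),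
  Thm. 1.1, Rem. 1.2, Cor. 1.5, Rem. 1.6–1.7, Cor. 1.8, §1.2, §1.3, §3. [`Palasek2025`]
* H. Koch, D. Tataru, Adv. Math. 157 (2001), Thm. 2. [`KochTataruAdvMath2001`]
* T. Tao, *A quantitative formulation of the global regularity problem for the periodic
  Navier–Stokes equation*, Dynamics of PDE 4 (2007) = arXiv:0710.1604. [`Tao2007QuantitativeFormulation`]
* W. Rusin, V. Šverák, J. Funct. Anal. 260 (2011). [`RusinSverak2011`]; H. Jia, V. Šverák, SIAM J.
  Math. Anal. 45 (2013). [`JiaSverak2013`]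
* J. Bourgain, N. Pavlović, J. Funct. Anal. 255 (2008). [`BourgainPavlovic2008`]; B. Wang, Adv.
  Math. 268 (2015). [`Wang2015`]
* M. P. Coiculescu, S. Palasek, Invent. Math. 244 (2025) = arXiv:2503.14699. [`CoiculescuPalasek2025`]
* H. Bahouri, J.-Y. Chemin, R. Danchin, *Fourier Analysis and Nonlinear PDE*, GL 343 (2011),
  Def. 2.15, Rem. 2.17, Prop. 2.18. [`BahouriCheminDanchinGL343`]
-/

noncomputable section

open MeasureTheory Set UnitAddTorus
open scoped ENNReal NNReal SchwartzMap

namespace Literature.Barriers.NavierStokesRegularity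

open Literature.Analysis.FunctionSpaces Literature.Analysis.FluidPDE

/-- **Barrier (Palasek 2025, Thm. 1.1): smooth data bounded in the critical space `B^{-1}_{∞,1}`
(hence in Koch–Tataru's `BMO⁻¹`) produce GLOBAL classical solutions of arbitrarily large
critical size — unit-torus rendering, weaker than print (module docstring).** There is an
absolute constant `C` such that for every non-zero `η ∈ ℤ³` and `Θ ∈ ℝ³` with `Θ · η = 0`, every
`ε > 0` and every `n_max`, there are a smooth, divergence-free, zero-mean datum `u₀` on
`𝕋³ = (ℝ/ℤ)³` whose periodic lift has a tempered distribution `U₀` with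
`‖U₀‖_{Ḃ^{-1}_{∞,1}} ≤ C`, and a global classical solution `(u, p)` of the unforced
Navier–Stokes equations (`ν = 1`) on `[0,∞) × 𝕋³` with `u(0) = u₀`, such that on the window
`t ∈ [1/(8π²|η|²), 1/(2π²|η|²)]` the solution is the decaying shear wave
`e^{−4π²|η|²t} sin(2πη·y) Θ` up to an error whose lifted derivatives of every order `n ≤ n_max`
are `≤ ε` pointwise. The size `|Θ|` is free while `C` is not: "arbitrary norm growth in the
well-posed setting", by an autonomous inverse cascade encoded in the datum.
[cite: Palasek2025, Thm. 1.1 with Rem. 1.2 and §1.3 (Besov norms); §1.2 (mechanism)]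

BARRIER (structured block, D-0021):
technique_class: critical-data-a-priori-estimate quantitative-regularity-from-critical-norm scale-invariant-a-priori-bound a-priori-estimate critical-regularity koch-tataru-large-data bmo-inverse perturbative-mild-solution-large-data
blocks: every hypothetical a priori estimate of the shape "scale-invariant quantity of the solution on `(0,T)` (or on `(0, T(size of datum))`, `T(·)` non-increasing) `≤ F(‖u₀‖_X)`, `F` non-decreasing", with `X = BMO⁻¹` or the smaller `B^{-1}_{∞,1}`, for the quantities (E1) `sup_t ‖u(t)‖_{BMO⁻¹}` (even `sup_t ‖u(t)‖_{B^{-1}_{∞,∞}}`), (E2)ₙ `sup_t t^{(1+n)/2}‖∇ⁿu(t)‖_∞`, (E3) `sup_t t^{1/4}‖ω(t)‖_{L²(B(0,√t))}`, (E4) `‖u‖_{L^p([T/2,T];L^q(B(√t)))}` (`2/p+3/q = 1`) and "essentially any scale-invariant measure of the solution" — EVEN RESTRICTED to smooth data with global smooth solutions [cite: Palasek2025, Cor. 1.5, Rem. 1.6, Rem. 1.7]; in-tree the (E2)₀ member with `X = B^{-1}_{∞,1}` is refuted as `CriticalDataArbitraryNormGrowth.not_apriori_sqrt_mul_norm_le`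 (data-dependent `T`) / `…_fixed`; hence any regularity or Type-II-exclusion argument for `NavierStokesRegularity` whose output would be such a bound (the critical-space analogue of Tao's `H¹` quantitative formulation [cite: Tao2007QuantitativeFormulation, Thm. 1.4 and Cor. 1.5], proved equivalent to regularity for `X = Ḣ^{1/2}` resp. `L³` in the form (E2) [cite: RusinSverak2011, Thm. 1.1] [cite: JiaSverak2013, Thm. 1]) cannot extend to `X = BMO⁻¹` or `B^{-1}_{∞,1}`; and the Koch–Tataru Picard scheme does not converge in any ball of `X_T` from some data in a fixed ball of `VMO⁻¹ ∩ C^∞` [cite: Palasek2025, Cor. 1.8].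
because: data supported in one frequency shell `N_{k_*}` of `B^{-1}_{∞,∞}`-size `O(1)` trigger an autonomous inverse cascade `N_{k_*} → N_{k_*−1} → … → N₀` through the high-high-to-low interaction `P_{N_{k−1}}ℙ div (P_{N_k}u ⊗ P_{N_k}u)`, each step SQUARING the critical amplitude, `C_k ∼ N_k (C_{k+1}/N_{k+1})²`, so `C_k ∼ N_k (C₀/N₀)^{2^{-k}}` and any target `C₀/N₀` is reached from `O(1)` data by taking `k_*` large, at no cost in `B^{-1}_{∞,1}` since a single shell is present at `t = 0`; the spent shells are erased by the heat flow, leaving `Θ_* sin(x·η_*)e^{−|η_*|²t} + E` [cite: Palasek2025, §1.2 and Thm. 1.1]; Cor. 1.5 follows with `Θ_* = n e₁`, `η_* = m e₂`, `ε_* = 1`, `n_max = 0`: `sup_{t ≤ T} √t‖u_{n,m}(t)‖_∞ ≳ (n−1)/m` with `‖u⁰_{n,m}‖_{B^{-1}_{∞,1}} ≤ 10⁵` [cite: Palasek2025, §3].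
evasions_known: (1) SMALL critical data: for `‖u₀‖_{BMO⁻¹} < ε₀` the Koch–Tataru solution is global with `‖u‖_{X_∞} ≲ ‖u₀‖_{BMO⁻¹}` — the in-tree `Literature.Analysis.FluidPDE.koch_tataru` [cite: KochTataruAdvMath2001, Thm. 2]; the growth mechanism needs LARGE data, `C₀ ≫ N₀` [cite: Palasek2025, §1.2 (last paragraph)]; (2) SUBCRITICAL or "well-posed critical" data norms: Tao's `H¹` a priori bound IS equivalent to regularity [cite: Tao2007QuantitativeFormulation, Thm. 1.4], and (E2)-type bounds from `X = Ḣ^{1/2}`, `L³` are equivalent to regularity [cite: RusinSverak2011, Thm. 1.1] [cite: JiaSverak2013, Thm. 1] ("well-posed spaces", where the number of critically-sized frequency scales is controlled by the norm [cite: Palasek2025, §1.1]) — the barrier bites only in the borderline class `L^{3,∞}`, `Ḃ^{-1+3/p}_{p,∞}`, `BMO⁻¹` and below, and is PROVED only for `BMO⁻¹` / `B^{-1}_{∞,q}` [cite: Palasek2025, §1.1 and Rem. 1.6]; (3) estimates whose right-hand side sees more than a critical norm of the datum (e.g. its frequency support / number of active scales `k_*`, or a profile decomposition) are untouched: the printed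 data have `k_*(Θ_*) → ∞` active construction scales [cite: Palasek2025, §1.2].
scope_caveats: (a) `𝕋³` only, as printed; the extension to decaying solutions on `ℝ³` is announced as expected "with some technical modifications", not proved [cite: Palasek2025, §1 (footnote 1)]; (b) the fact records Thm. 1.1 with `∃ C` in place of the printed `‖u⁰‖_{B^{-1}_{∞,1}} ≤ 10⁵` (unit-torus period and the tree's Littlewood–Paley cut-off change the constant by a bounded factor [cite: BahouriCheminDanchinGL343, Rem. 2.17 and Prop. 2.18]; "the upper bound `10⁵` is far from optimal" [cite: Palasek2025, Rem. 1.2]); (c) of Cor. 1.5 only (E2)₀ with the `B^{-1}_{∞,1}` right-hand side is PROVED here ((E1), (E3), (E4), (E2)ₙ≥₁, the `BMO⁻¹` right-hand sides and Cor. 1.8 are printed [cite: Palasek2025, Cor. 1.5, Rem. 1.6, Cor. 1.8] but need torus `BMO⁻¹`/`Ḃ^{-1}_{∞,∞}`/`X_T` vocabulary not threaded); (d) NOT an ill-posedness or blow-up statement: all solutions are global and smooth, the data-to-solution map is continuous at each datum (`VMO⁻¹` local well-posedness [cite: KochTataruAdvMath2001, Thm. 2]), and nothing is said about `NavierStokesRegularity`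 itself — only about PROOFS that would output a critical-data a priori bound; norm inflation from SMALL data (Bourgain–Pavlović, `Ḃ^{-1}_{∞,∞}`; Wang, `B^{-1}_{∞,q}`) is a different phenomenon, catalogued as `CriticalBesovNormInflation` [cite: BourgainPavlovic2008, Thm. 1.1] [cite: Wang2015, Thm. 1.2] [cite: Palasek2025, §1.1]; large-data NON-uniqueness in `BMO⁻¹` is the sibling `CriticalDataSmoothNonuniqueness` [cite: CoiculescuPalasek2025, Thm. 1.2]; (e) data bounded in `B^{-1}_{∞,1}` AND small in `B^{-1}_{∞,∞}` are expected by the author to behave the same way, without proof [cite: Palasek2025, Rem. 1.3].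
status: established -/
def CriticalDataArbitraryNormGrowth : Prop :=
  ∃ C : ℝ≥0,
    ∀ (η : Fin 3 → ℤ) (Θ : EuclideanSpace ℝ (Fin 3)), η ≠ 0 → Θ ≠ 0 →
      ∑ j, (η j : ℝ) * Θ j = 0 →
      ∀ ε : ℝ, 0 < ε → ∀ nmax : ℕ,
        ∃ (u₀ : UnitAddTorus (Fin 3) → EuclideanSpace ℝ (Fin 3))
          (U₀ : 𝓢'(EuclideanSpace ℝ (Fin 3), EuclideanSpace ℂ (Fin 3)))
          (u : ℝ → UnitAddTorus (Fin 3) → EuclideanSpace ℝ (Fin 3))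
          (p : ℝ → UnitAddTorus (Fin 3) → ℝ),
          Torus.IsSmooth u₀ ∧ Torus.IsDivFree u₀ ∧ Torus.HasZeroMean u₀ ∧
          IsDistributionOf (Torus.lift u₀) U₀ ∧
          eHomBesovNorm (-1) ∞ 1 U₀ ≤ (C : ℝ≥0∞) ∧
          Torus.IsClassicalNSSolutionOn (Ici 0) 1 0 u p ∧ u 0 = u₀ ∧
          ∀ t ∈ Icc (1 / (8 * Real.pi ^ 2 * Torus.freqNormSq η))
              (1 / (2 * Real.pi ^ 2 * Torus.freqNormSq η)),
            ∀ n : ℕ, n ≤ nmax → ∀ x : EuclideanSpace ℝ (Fin 3),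
              ‖iteratedFDeriv ℝ n
                  (Torus.lift fun y => u t y -
                    Real.exp (-(4 * Real.pi ^ 2 * Torus.freqNormSq η * t)) •
                      (mFourier η y).im • Θ) x‖ ≤ ε

/-! ### The printed witnesses of §3: `η = m e₀`, `Θ = θ e₁`, read at `y = e₀/(4m)` -/

/-- The lifted character in exponential form, `e_k(proj y) = exp(2πi ∑ᵢ kᵢ yᵢ)` (copy of the
folklore identity `Literature.Analysis.FluidPDE.Torus.mFourier_proj_eq_cexp`, reproved to keep
the imports of this catalogue entry small). [folklore] -/
private theorem mFourier_proj_eq_cexp' (k : Fin 3 → ℤ) (y : EuclideanSpace ℝ (Fin 3)) :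
    mFourier k (Torus.proj y) =
      Complex.exp (2 * Real.pi * Complex.I * ∑ i, ((k i : ℝ) : ℂ) * ((y i : ℝ) : ℂ)) := by
  simp only [mFourier, ContinuousMap.coe_mk, Torus.proj_apply, fourier_coe_apply,
    ← Complex.exp_sum]
  congr 1
  push_cast
  rw [Finset.mul_sum]
  refine Finset.sum_congr rfl fun i _ => ?_
  simp
  ring

/-- `|m e₀|² = m²`. [folklore] -/
private theorem freqNormSq_single (m : ℕ) :
    Torus.freqNormSq (Pi.single (0 : Fin 3) (m : ℤ)) = (m : ℝ) ^ 2 := by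
  simp [Torus.freqNormSq, Pi.single_apply]

/-- `m e₀ ⊥ θ e₁`. [folklore] -/
private theorem sum_single_mul_single (m : ℕ) (θ : ℝ) :
    ∑ j, ((Pi.single (0 : Fin 3) (m : ℤ) : Fin 3 → ℤ) j : ℝ) *
      EuclideanSpace.single (1 : Fin 3) θ j = 0 := by
  simp [Pi.single_apply]

/-- At the point `y = e₀/(4m)` the character `e_{m e₀}` takes the value `i`, so
`sin(2π m y₀) = Im e_{m e₀}(proj y) = 1`. [folklore] -/
private theorem im_mFourier_single_proj {m : ℕ} (hm : m ≠ 0) :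
    (mFourier (Pi.single (0 : Fin 3) (m : ℤ))
      (Torus.proj (EuclideanSpace.single (0 : Fin 3) (1 / (4 * (m : ℝ)))))).im = 1 := by
  rw [mFourier_proj_eq_cexp']
  have hsum : ∑ i : Fin 3, (((Pi.single (0 : Fin 3) (m : ℤ) : Fin 3 → ℤ) i : ℝ) : ℂ) *
      (((EuclideanSpace.single (0 : Fin 3) (1 / (4 * (m : ℝ)))) i : ℝ) : ℂ) = (1 / 4 : ℝ) := by
    have hm' : (m : ℝ) ≠ 0 := Nat.cast_ne_zero.2 hm
    simp only [Fin.sum_univ_three, Pi.single_apply, PiLp.single_apply]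
    simp only [Fin.isValue, ↓reduceIte, one_ne_zero, Fin.reduceEq, Int.cast_zero,
      Complex.ofReal_zero, zero_mul, add_zero, Int.cast_natCast, Complex.ofReal_natCast]
    push_cast
    field_simp
  rw [hsum]
  have hz : 2 * (Real.pi : ℂ) * Complex.I * ((1 / 4 : ℝ) : ℂ) =
      ((Real.pi / 2 : ℝ) : ℂ) * Complex.I := by
    push_cast
    ring
  rw [hz, Complex.exp_im]
  simp [Real.sin_pi_div_two]

/-- **Quantitative core of Palasek's Cor. 1.5 / Cor. 1.8** ("`sup_{t∈[0,T]} t^{1/2}‖u_{n,m}(t)‖_∞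
≳ (n−1)/m`, taking `m` large depending on `T`, then `n` large"): the fact yields ONE absolute
ball of `B^{-1}_{∞,1}` containing, for every `T > 0` and every `M`, a smooth divergence-free
zero-mean datum with a global classical solution `(u, p)` and a time `t ∈ (0,T)` and point `x`
at which `√t ‖u(t,x)‖ > M`. Printed proof: Thm. 1.1 with `η = m e₀` (`1/(8π²m²) < T`),
`Θ = θ e₁`, `ε = 1`, `n_max = 0`, read at `t = 1/(8π²m²)` and the point `y = e₀/(4m)` where
`sin(2πm y₀) = 1`. [cite: Palasek2025, §3 (proofs of Cor. 1.5 and Cor. 1.8)] -/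
theorem CriticalDataArbitraryNormGrowth.exists_sqrt_mul_norm_gt (h : CriticalDataArbitraryNormGrowth) :
    ∃ C : ℝ≥0, ∀ T M : ℝ, 0 < T →
      ∃ (u₀ : UnitAddTorus (Fin 3) → EuclideanSpace ℝ (Fin 3))
        (U₀ : 𝓢'(EuclideanSpace ℝ (Fin 3), EuclideanSpace ℂ (Fin 3)))
        (u : ℝ → UnitAddTorus (Fin 3) → EuclideanSpace ℝ (Fin 3))
        (p : ℝ → UnitAddTorus (Fin 3) → ℝ),
        Torus.IsSmooth u₀ ∧ Torus.IsDivFree u₀ ∧ Torus.HasZeroMean u₀ ∧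
        IsDistributionOf (Torus.lift u₀) U₀ ∧
        eHomBesovNorm (-1) ∞ 1 U₀ ≤ (C : ℝ≥0∞) ∧
        Torus.IsClassicalNSSolutionOn (Ici 0) 1 0 u p ∧ u 0 = u₀ ∧
        ∃ t ∈ Ioo 0 T, ∃ x : UnitAddTorus (Fin 3), M < Real.sqrt t * ‖u t x‖ := by
  obtain ⟨C, hC⟩ := h
  refine ⟨C, fun T M hT => ?_⟩
  -- `m` large depending on `T`: `1/(8π²m²) < T`
  have hπ : 0 < 8 * Real.pi ^ 2 := by positivity
  obtain ⟨m, hm⟩ := exists_nat_gt (1 / (8 * Real.pi ^ 2 * T))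
  have hm0 : 0 < (m : ℝ) := lt_trans (by positivity) hm
  have hmne : m ≠ 0 := by
    rintro rfl
    simp at hm0
  set η : Fin 3 → ℤ := Pi.single (0 : Fin 3) (m : ℤ) with hη
  have hηne : η ≠ 0 := by
    intro h0
    have := congr_fun h0 0
    simp [hη, hmne] at this
  have hfreq : Torus.freqNormSq η = (m : ℝ) ^ 2 := freqNormSq_single m
  set t₁ : ℝ := 1 / (8 * Real.pi ^ 2 * Torus.freqNormSq η) with ht₁
  have ht₁pos : 0 < t₁ := by rw [ht₁, hfreq]; positivity
  have ht₁T : t₁ < T := by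
    rw [ht₁, hfreq]
    have hmm : (m : ℝ) ≤ (m : ℝ) ^ 2 := by
      have h1 : (1 : ℝ) ≤ m := by exact_mod_cast Nat.one_le_iff_ne_zero.2 hmne
      nlinarith
    have hlt : 1 / (8 * Real.pi ^ 2 * T) < (m : ℝ) ^ 2 := lt_of_lt_of_le hm hmm
    rw [div_lt_iff₀ (by positivity)] at hlt
    rw [div_lt_iff₀ (by positivity)]
    linarith [mul_comm ((m : ℝ) ^ 2) (8 * Real.pi ^ 2 * T)]
  -- the decay factor at `t₁` and the amplitude `θ`, large depending on `m` and `M`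
  set c : ℝ := Real.exp (-(4 * Real.pi ^ 2 * Torus.freqNormSq η * t₁)) with hc
  have hcpos : 0 < c := Real.exp_pos _
  set θ : ℝ := (|M| / Real.sqrt t₁ + 2) / c with hθ
  have hθpos : 0 < θ := by rw [hθ]; positivity
  set Θ : EuclideanSpace ℝ (Fin 3) := EuclideanSpace.single (1 : Fin 3) θ with hΘ
  have hΘne : Θ ≠ 0 := by
    intro h0
    have := congr_arg (fun v : EuclideanSpace ℝ (Fin 3) => v 1) h0
    simp [hΘ, hθpos.ne'] at this
  have hperp : ∑ j, (η j : ℝ) * Θ j = 0 := sum_single_mul_single m θ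
  obtain ⟨u₀, U₀, u, p, hsm, hdiv, hmean, hdist, hnorm, hsol, hinit, herr⟩ :=
    hC η Θ hηne hΘne hperp 1 one_pos 0
  refine ⟨u₀, U₀, u, p, hsm, hdiv, hmean, hdist, hnorm, hsol, hinit, t₁, ⟨ht₁pos, ht₁T⟩, ?_⟩
  -- read the error bound at `t = t₁`, `n = 0`, `y = e₀/(4m)`
  set y : EuclideanSpace ℝ (Fin 3) := EuclideanSpace.single (0 : Fin 3) (1 / (4 * (m : ℝ))) with hy
  have ht₁mem : t₁ ∈ Icc (1 / (8 * Real.pi ^ 2 * Torus.freqNormSq η))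
      (1 / (2 * Real.pi ^ 2 * Torus.freqNormSq η)) := by
    refine ⟨le_rfl, ?_⟩
    rw [ht₁, hfreq]
    exact one_div_le_one_div_of_le (by positivity) (by nlinarith [sq_nonneg (m : ℝ), Real.pi_pos])
  have him : (mFourier η (Torus.proj y)).im = 1 := im_mFourier_single_proj hmne
  have hE := herr t₁ ht₁mem 0 le_rfl y
  rw [norm_iteratedFDeriv_zero, Torus.lift_apply, him, one_smul] at hE
  -- reverse triangle inequality: `‖u(t₁, proj y)‖ ≥ cθ − 1 = |M|/√t₁ + 1`
  refine ⟨Torus.proj y, ?_⟩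
  have hmode : ‖c • Θ‖ = c * θ := by
    rw [norm_smul, Real.norm_of_nonneg hcpos.le, hΘ, PiLp.norm_single,
      Real.norm_of_nonneg hθpos.le]
  have hcθ : c * θ = |M| / Real.sqrt t₁ + 2 := by
    rw [hθ, mul_div_cancel₀ _ hcpos.ne']
  have hlow : |M| / Real.sqrt t₁ + 1 ≤ ‖u t₁ (Torus.proj y)‖ := by
    have h1 : ‖c • Θ‖ - ‖u t₁ (Torus.proj y) - c • Θ‖ ≤ ‖u t₁ (Torus.proj y)‖ := by
      have := norm_sub_norm_le (c • Θ) (c • Θ - u t₁ (Torus.proj y))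
      rw [sub_sub_cancel, ← norm_neg (c • Θ - u t₁ (Torus.proj y)), neg_sub] at this
      linarith
    rw [hmode, hcθ] at h1
    linarith
  have hsqrt : 0 < Real.sqrt t₁ := Real.sqrt_pos.2 ht₁pos
  calc M ≤ |M| := le_abs_self M
    _ < |M| + Real.sqrt t₁ := by linarith
    _ = Real.sqrt t₁ * (|M| / Real.sqrt t₁ + 1) := by field_simp
    _ ≤ Real.sqrt t₁ * ‖u t₁ (Torus.proj y)‖ := by gcongr

/-- **Cor. 1.5 (E2)₀ with data-dependent time (Palasek 2025, Cor. 1.5 and the sentence after it,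
right-hand side `B^{-1}_{∞,1}` by Rem. 1.6), PROVED from the fact.** For every non-increasing
positive `T(·)` and every non-decreasing real `F`, it is NOT true that every smooth
divergence-free zero-mean datum `u₀` on `𝕋³` with a global classical solution `(u,p)` obeys
`√t ‖u(t,x)‖ ≤ F(‖u₀‖_{Ḃ^{-1}_{∞,1}})` for all `t ∈ (0, T(‖u₀‖_{Ḃ^{-1}_{∞,1}}))` and all `x`
(norm of the tempered distribution of the periodic lift, as in the fact).
[cite: Palasek2025, Cor. 1.5 (E2) with "More strongly … T = T(‖u⁰‖)" and Rem. 1.6] -/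
theorem CriticalDataArbitraryNormGrowth.not_apriori_sqrt_mul_norm_le
    (h : CriticalDataArbitraryNormGrowth) (Tf : ℝ≥0∞ → ℝ) (hTf : Antitone Tf) (hTpos : ∀ r, 0 < Tf r)
    (F : ℝ≥0∞ → ℝ) (hF : Monotone F) :
    ¬ ∀ (u₀ : UnitAddTorus (Fin 3) → EuclideanSpace ℝ (Fin 3))
        (U₀ : 𝓢'(EuclideanSpace ℝ (Fin 3), EuclideanSpace ℂ (Fin 3)))
        (u : ℝ → UnitAddTorus (Fin 3) → EuclideanSpace ℝ (Fin 3))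
        (p : ℝ → UnitAddTorus (Fin 3) → ℝ),
        Torus.IsSmooth u₀ → Torus.IsDivFree u₀ → Torus.HasZeroMean u₀ →
        IsDistributionOf (Torus.lift u₀) U₀ →
        Torus.IsClassicalNSSolutionOn (Ici 0) 1 0 u p → u 0 = u₀ →
        ∀ t ∈ Ioo 0 (Tf (eHomBesovNorm (-1) ∞ 1 U₀)), ∀ x : UnitAddTorus (Fin 3),
          Real.sqrt t * ‖u t x‖ ≤ F (eHomBesovNorm (-1) ∞ 1 U₀) := by
  intro hyp
  obtain ⟨C, hC⟩ := h.exists_sqrt_mul_norm_gt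
  obtain ⟨u₀, U₀, u, p, hsm, hdiv, hmean, hdist, hnorm, hsol, hinit, t, ht, x, hlt⟩ :=
    hC (Tf C) (F C) (hTpos C)
  have hT : t ∈ Ioo 0 (Tf (eHomBesovNorm (-1) ∞ 1 U₀)) :=
    ⟨ht.1, lt_of_lt_of_le ht.2 (hTf hnorm)⟩
  have hle := hyp u₀ U₀ u p hsm hdiv hmean hdist hsol hinit t hT x
  exact absurd (lt_of_lt_of_le hlt (hle.trans (hF hnorm))) (lt_irrefl _)

/-- **Cor. 1.5 (E2)₀, fixed `T` (Palasek 2025, Cor. 1.5, right-hand side `B^{-1}_{∞,1}` by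
Rem. 1.6), PROVED from the fact**: for every `T > 0` and non-decreasing real `F` the a priori
estimate `sup_{t∈(0,T)} √t‖u(t)‖_∞ ≤ F(‖u₀‖_{Ḃ^{-1}_{∞,1}})` over smooth divergence-free zero-mean
data with a global classical solution FAILS. [cite: Palasek2025, Cor. 1.5 (E2) and Rem. 1.6] -/
theorem CriticalDataArbitraryNormGrowth.not_apriori_sqrt_mul_norm_le_fixed
    (h : CriticalDataArbitraryNormGrowth) {T : ℝ} (hT : 0 < T) (F : ℝ≥0∞ → ℝ) (hF : Monotone F) :
    ¬ ∀ (u₀ : UnitAddTorus (Fin 3) → EuclideanSpace ℝ (Fin 3))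
        (U₀ : 𝓢'(EuclideanSpace ℝ (Fin 3), EuclideanSpace ℂ (Fin 3)))
        (u : ℝ → UnitAddTorus (Fin 3) → EuclideanSpace ℝ (Fin 3))
        (p : ℝ → UnitAddTorus (Fin 3) → ℝ),
        Torus.IsSmooth u₀ → Torus.IsDivFree u₀ → Torus.HasZeroMean u₀ →
        IsDistributionOf (Torus.lift u₀) U₀ →
        Torus.IsClassicalNSSolutionOn (Ici 0) 1 0 u p → u 0 = u₀ →
        ∀ t ∈ Ioo 0 T, ∀ x : UnitAddTorus (Fin 3),
          Real.sqrt t * ‖u t x‖ ≤ F (eHomBesovNorm (-1) ∞ 1 U₀) :=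
  h.not_apriori_sqrt_mul_norm_le (fun _ => T) (fun _ _ _ => le_rfl) (fun _ => hT) F hF

end Literature.Barriers.NavierStokesRegularity
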